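import Mathlib
import Summits.PneNP.PneNP.Statement
import Summits.PneNP.PneNP.Theorems.SoloBlindAnchor
import Summits.PneNP.PneNP.Theorems.SoloBlindEquivalentForms
import Summits.PneNP.PneNP.Theorems.SoloBlindStreamingFooling
import Literature.Computability.Complexity.DTIMEPowSsubsetP
import Literature.Computability.Complexity.LengthCompare
import Literature.Computability.Complexity.StringCopy
import Literature.Computability.Complexity.CodeFPArith
import Literature.Computability.Complexity.PRelHierarchy
import Literature.Barriers.QuantumAdvantage.TQBFSavitchCode
import Literature.Barriers.PneNP.MCSPHardnessObstructions
import HarnessLib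

/-!
# A sparse language in `P ∖ DTIME(nᵏ)`, and "uniform magnification for ALL sparse languages" is `P ≠ NP`

(Solo seat `solo-PneNP-blind`, PROPOSITION G′ of the seat's report.)

McKay–Murray–Williams (STOC 2019, Thm. 1.3) prove `P ≠ NP` from a modest UNIFORM lower bound for
ONE specific sparse language (`MCSP[s]`), and ask (§6, "Sparse Problems?") what happens for sparse
problems in general; Atserias–Müller ask whether "any `2^{n^{o(1)}}`-sparse problem" can be plugged
into a uniform magnification theorem. In the Turing-machine model the answer is immediate and is
recorded here in the kernel: a uniform magnification theorem for ALL sparse languages — even with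
the feeble conclusion "decidable in time `O(nᵏ)`", even restricted to sparse languages that are
already in `P` — is EQUIVALENT to `P ≠ NP`, because the deterministic time hierarchy has sparse
witnesses.

* `SoloBlind.boolIndicator_inf_of_mem`, `SoloBlind.diagLang_inf_not_mem_DTIME` — for every fuelled
  universal decider `𝒮` (`TimeHierarchyDiagonal.lean`), `T, U ≥ id` with `T² / U → 0`, and every
  language `S` containing, for each header `e`, all sufficiently padded words `⟨e, 0ᵐ⟩`, the
  restricted diagonal language `𝒮.diagLang U ⊓ S` is not in `DTIME T`: the tree's diagonal step
  (`FuelledSimulator.diagLang_not_mem_DTIME`, Hartmanis–Stearns / Arora–Barak Thm. 3.1) only ever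
  uses the words `⟨e_M, 0ᴺ⟩` with `N` large, and those lie in `S`, where the two languages agree;
* `SoloBlind.sparseHdr_isSparseLanguage`, `SoloBlind.sparseHdr_mem_P` — the language of padded
  short headers `{⟨e, 0ᵐ⟩ : 2^{|e|} ≤ |⟨e, 0ᵐ⟩|}` is sparse (fewer than `2n` words of each length `n`)
  and in `P` (its indicator is assembled in the tree's `CodeFP` algebra);
* `SoloBlind.exists_sparse_mem_P_not_mem_DTIME_pow` — **for every `k` there is a SPARSE `L ∈ P` with
  `L ∉ DTIME(nᵏ)`** (the sparse form of `exists_mem_P_not_mem_DTIME_pow`, `DTIMEPowSsubsetP.lean`);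
* `SoloBlind.sparseMagnification_iff_pneNP` — **PROPOSITION G′**: for every `k`,
  `(∀ L sparse, L ∈ P → (NP ⊆ P → L ∈ DTIME(nᵏ))) ↔ PneNP`; and the one-language form
  `SoloBlind.exists_sparse_magnification_iff_pneNP`: some explicit sparse `L ∈ P` has
  `(NP ⊆ P → L ∈ DTIME(nᵏ)) ↔ PneNP`.

Reading: "hardness magnification for all sparse (even `P`-) languages" is false-or-the-summit in
every model with a tight deterministic time hierarchy; a magnification theorem must single out
sparse languages with additional structure (compressible, `PH`-presentable YES-instances), as MMW's
`MCSP[s]` and `MKTP` do. Nearest printed statement: Hartmanis–Immerman–Sewelson 1985, Thm. 1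
(`∃` sparse `S ∈ NP ∖ P ↔ E ≠ NE`; tree `hartmanisImmermanSewelson1985_thm1`), the `E`-level shadow.

References: D. M. McKay, C. D. Murray, R. R. Williams, *Weak lower bounds on resource-bounded
compression imply strong separations of complexity classes*, STOC 2019, Thm. 1.3 and §6
[bib: McKayMurrayWilliams2019]; A. Atserias, M. Müller, arXiv:2503.24061, p. 5; J. Hartmanis,
R. E. Stearns, Trans. AMS 117 (1965), Thm. 9 / Cor. 9.1 [bib: HartmanisStearns1965]; S. Arora,
B. Barak, *Computational Complexity* (2009), Thm. 3.1 [bib: AroraBarakCC2009]; J. Hartmanis,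
N. Immerman, V. Sewelson, Inform. Control 65 (1985), Thm. 1 [bib: HartmanisImmermanSewelson1985].
-/

namespace Summit.PneNP.PneNP.Theorems.SoloBlind

open Computability Turing Filter Topology
open Literature.Computability.Complexity
open Literature.Barriers.PneNP (IsSparseLanguage)

/-! ### The diagonal step, restricted to a set containing all long paddings -/

/-- On a word of `S`, the indicator of `L ⊓ S` is the indicator of `L`. [folklore] -/
theorem boolIndicator_inf_of_mem {L S : Language Bool} {x : List Bool} (hxS : x ∈ S) :
    (L ⊓ S).boolIndicator x = L.boolIndicator x := by
  by_cases hx : x ∈ L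
  · have h2 : x ∈ L ⊓ S := And.intro hx hxS
    rw [(Set.mem_iff_boolIndicator _ _).1 hx, (Set.mem_iff_boolIndicator _ _).1 h2]
  · have h2 : x ∉ L ⊓ S := fun h => hx (And.left h)
    rw [(Set.notMem_iff_boolIndicator _ _).1 hx, (Set.notMem_iff_boolIndicator _ _).1 h2]

/-- **The restricted diagonal language is not in `DTIME T`.** For a fuelled universal decider `𝒮`,
`T n ≥ n`, `U n ≥ n`, `T² / U → 0`, and ANY language `S` that contains, for every header `e`, all
sufficiently padded words `⟨e, 0ᵐ⟩` (`m ≥ m₀(e)`), the language `𝒮.diagLang U ⊓ S` is not in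
`DTIME T`: a decider `M` in time `c T + c` would be flipped by the simulator on its own padded header
`x = ⟨e_M, 0ᴺ⟩` with `N ≥ m₀(e_M)` and `κ (cT(n) + c + n)² + κ ≤ U(n)` — a word IN `S`, where the two
languages agree. (The tree's diagonal step `FuelledSimulator.diagLang_not_mem_DTIME`, verbatim, with
one extra lower bound on the padding.) [cite: AroraBarakCC2009, Thm. 3.1 (proof)] [cite: HartmanisStearns1965, Thm. 9 / Cor. 9.1] -/
theorem diagLang_inf_not_mem_DTIME (𝒮 : FuelledSimulator) {T U : ℕ → ℕ}
    (hT : ∀ n, n ≤ T n) (hU : ∀ n, n ≤ U n)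
    (h : Tendsto (fun n => (T n : ℝ) ^ 2 / U n) atTop (𝓝 0)) {S : Language Bool}
    (hS : ∀ e : List Bool, ∃ m₀ : ℕ, ∀ m : ℕ, m₀ ≤ m → boolPair e (List.replicate m false) ∈ S) :
    𝒮.diagLang U ⊓ S ∉ DTIME T := by
  rintro ⟨c, M, hM⟩
  obtain ⟨e, κ, he⟩ := 𝒮.universal M
  -- room: eventually `κ (2c+2)² T² + κ (2c+2)² ≤ U`
  obtain ⟨N₀, hN₀⟩ := eventually_mul_sq_add_le_of_tendsto_sq_div hU h (κ * (2 * c + 2) ^ 2)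
  obtain ⟨m₀, hm₀⟩ := hS e
  -- a padding length large enough for the room AND for membership in `S`
  obtain ⟨N, hN, hNS⟩ : ∃ N : ℕ,
      (∀ n : ℕ, N ≤ n → κ * (2 * c + 2) ^ 2 * T n ^ 2 + κ * (2 * c + 2) ^ 2 ≤ U n) ∧
        boolPair e (List.replicate N false) ∈ S :=
    ⟨max N₀ m₀, fun n hn => hN₀ n (le_trans (le_max_left _ _) hn), hm₀ _ (le_max_right _ _)⟩
  have hlen : N ≤ (boolPair e (List.replicate N false)).length := by simp
  -- the decider's run on its own padded header `x = ⟨e, 0ᴺ⟩ ∈ S`, where the two languages agree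
  have hrun : M.OutputsWithin (boolPair e (List.replicate N false))
      (encodeBool ((𝒮.diagLang U).boolIndicator (boolPair e (List.replicate N false))))
      (c * T (boolPair e (List.replicate N false)).length + c) := by
    have := hM (boolPair e (List.replicate N false))
    rwa [boolIndicator_inf_of_mem hNS] at this
  rw [FuelledSimulator.boolIndicator_diagLang] at hrun
  -- the fuel `U n` suffices (`n = |x| ≤ T n`)
  have hroom : κ * (c * T (boolPair e (List.replicate N false)).length + c +
      (boolPair e (List.replicate N false)).length) ^ 2 + κ ≤
      U (boolPair e (List.replicate N false)).length := by
    generalize hn : (boolPair e (List.replicate N false)).length = n at hlen ⊢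
    have hTn : n ≤ T n := hT n
    have hn1 : 1 ≤ n := by rw [← hn, length_boolPair]; omega
    have hT1 : c ≤ c * T n := by
      simpa using Nat.mul_le_mul_left c (le_trans hn1 hTn)
    have h1 : c * T n + c + n ≤ (2 * c + 2) * T n := by nlinarith
    have h2 : κ * (c * T n + c + n) ^ 2 ≤ κ * (2 * c + 2) ^ 2 * T n ^ 2 := by
      have := Nat.pow_le_pow_left h1 2
      calc κ * (c * T n + c + n) ^ 2 ≤ κ * ((2 * c + 2) * T n) ^ 2 := Nat.mul_le_mul_left κ this
        _ = κ * (2 * c + 2) ^ 2 * T n ^ 2 := by ring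
    have h3 : κ ≤ κ * (2 * c + 2) ^ 2 := by
      have : 1 ≤ (2 * c + 2) ^ 2 := Nat.one_le_pow _ _ (by omega)
      nlinarith
    have h4 := hN n hlen
    omega
  -- the simulator flips the decider's answer, which is the simulator's own answer
  have hflip := he (List.replicate N false) _ _ _ hrun hroom
  have absurd : ∀ b : Bool, b = !b → False := by decide
  exact absurd _ hflip

/-! ### The sparse `P`-language of padded short headers -/

/-- The Boolean test for membership in the language of padded short headers
`{x | ∃ e m, x = ⟨e, 0ᵐ⟩ ∧ 2^{|e|} ≤ |x|}`: decode the pair, re-encode and compare, check that the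
padding is all-`0` and that the header is short. [folklore] -/
theorem sparseHdr_test_iff (x : List Bool) :
    (decide (boolPair (fstP x) (sndP x) = x) &&
        (decide (sndP x = List.replicate (sndP x).length false) &&
          decide (2 ^ (fstP x).length ≤ x.length))) = true ↔
      ∃ (e : List Bool) (m : ℕ), x = boolPair e (List.replicate m false) ∧ 2 ^ e.length ≤ x.length := by
  simp only [Bool.and_eq_true, decide_eq_true_eq]
  constructor
  · rintro ⟨h1, h2, h3⟩
    exact ⟨fstP x, (sndP x).length, by rw [← h2]; exact h1.symm, h3⟩
  · rintro ⟨e, m, rfl, h⟩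
    simp only [fstP_boolPair, sndP_boolPair, List.length_replicate, true_and]
    exact h

/-- The indicator of the language of padded short headers is computed on codes (tree `CodeFP`
algebra: pair projections `fstP`/`sndP ∈ FP`, re-pairing, string equality, `1ᵐ ↦ 0ᵐ`,
`|e| ↦ 2^{|e|}` in binary, comparison). [cite: AroraBarak2009, §1.3 (closure of polynomial time)] -/
theorem cf_sparseHdr_test :
    CodeFP CodeFP.strE CodeFP.bitE (fun x : List Bool =>
      decide (boolPair (fstP x) (sndP x) = x) &&
        (decide (sndP x = List.replicate (sndP x).length false) &&
          decide (2 ^ (fstP x).length ≤ x.length))) := by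
  have hinj : Function.Injective CodeFP.strE := fun _ _ h => h
  have hF : CodeFP CodeFP.strE CodeFP.strE fstP := CodeFP.of_fn fstP fstP_mem_FP fun _ => rfl
  have hS : CodeFP CodeFP.strE CodeFP.strE sndP := CodeFP.of_fn sndP sndP_mem_FP fun _ => rfl
  have hP : CodeFP CodeFP.strE CodeFP.strE (fun x => boolPair (fstP x) (sndP x)) :=
    (hF.pair hS).recodeOut fun _ => rfl
  have h1 : CodeFP CodeFP.strE CodeFP.bitE (fun x => decide (boolPair (fstP x) (sndP x) = x)) :=
    (CodeFP.eq hinj).comp (hP.pair (CodeFP.id CodeFP.strE))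
  have h2 : CodeFP CodeFP.strE CodeFP.bitE
      (fun x => decide (sndP x = List.replicate (sndP x).length false)) :=
    (CodeFP.eq hinj).comp (hS.pair
      (Literature.Barriers.QuantumAdvantage.TQBFRed.strZeros.comp (CodeFP.strLength.comp hS)))
  have h3 : CodeFP CodeFP.strE CodeFP.bitE (fun x => decide (2 ^ (fstP x).length ≤ x.length)) :=
    CodeFP.natLe.comp ((CodeFP.natPow.comp ((CodeFP.const CodeFP.strE 2).pair
      (CodeFP.strLength.comp hF))).pair CodeFP.strNatLength)
  exact h1.and (h2.and h3)

/-- **The language of padded short headers is in `P`.** [cite: AroraBarak2009, Def. 1.13 and §1.3] -/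
theorem sparseHdr_mem_P :
    ({x | ∃ (e : List Bool) (m : ℕ), x = boolPair e (List.replicate m false) ∧
        2 ^ e.length ≤ x.length} : Language Bool) ∈ Classes.P := by
  obtain ⟨f, hf, hfx⟩ := cf_sparseHdr_test
  simp only [CodeFP.strE, id_eq] at hfx
  refine mem_P_of_mem_FP hf _ fun w => ⟨fun hw => ?_, fun hw => ?_⟩
  · rw [hfx w, (sparseHdr_test_iff w).2 hw]
    rfl
  · rw [hfx w, Bool.eq_false_iff.2 fun h => hw ((sparseHdr_test_iff w).1 h)]
    rfl

/-- A finite set of words of length `≤ s` has fewer than `2^(s+1)` elements (`Set.ncard` form of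
`card_lt_two_pow_of_length_le`). [folklore] -/
theorem ncard_lt_two_pow_of_length_le {G : Set (List Bool)} (hG : G.Finite) {s : ℕ}
    (h : ∀ w ∈ G, w.length ≤ s) : G.ncard < 2 ^ (s + 1) := by
  rw [Set.ncard_eq_toFinset_card G hG]
  exact card_lt_two_pow_of_length_le _ fun w hw => h w (hG.mem_toFinset.1 hw)

/-- **The language of padded short headers is sparse**: its words of length `n` are
`⟨e, 0^{n-2|e|-2}⟩` with `2^{|e|} ≤ n`, i.e. `|e| ≤ ⌊log₂ n⌋`; they are determined by `e`, so there
are fewer than `2^{⌊log₂ n⌋+1} ≤ 2n ≤ n² + 2` of them. [cite: MurrayWilliams2017, §4.1 (p. 14) (definition of sparse)] -/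
theorem sparseHdr_isSparseLanguage :
    IsSparseLanguage
      ({x | ∃ (e : List Bool) (m : ℕ), x = boolPair e (List.replicate m false) ∧
          2 ^ e.length ≤ x.length} : Language Bool) := by
  refine ⟨2, fun n => ?_⟩
  set G : Set (List Bool) := {x : List Bool | x ∈ ({x | ∃ (e : List Bool) (m : ℕ),
      x = boolPair e (List.replicate m false) ∧ 2 ^ e.length ≤ x.length} : Language Bool) ∧
        x.length = n} with hG
  -- every word of the slice is `⟨fstP x, 0^{…}⟩` with a short header
  have key : ∀ x ∈ G, (fstP x).length ≤ Nat.log 2 n ∧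
      x = boolPair (fstP x) (List.replicate (n - (2 * (fstP x).length + 2)) false) := by
    rintro x ⟨⟨e, m, rfl, he⟩, hlen⟩
    rw [length_boolPair, List.length_replicate] at hlen he
    refine ⟨?_, ?_⟩
    · rw [fstP_boolPair]
      exact Nat.le_log_of_pow_le (by norm_num) (le_trans he hlen.le)
    · rw [fstP_boolPair]
      congr 2
      omega
  have hfin : G.Finite := (List.finite_length_eq Bool n).subset fun x hx => hx.2
  have hinj : Set.InjOn fstP G := fun x hx y hy hxy => by
    rw [(key x hx).2, (key y hy).2, hxy]
  have himg : (fstP '' G).ncard < 2 ^ (Nat.log 2 n + 1) :=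
    ncard_lt_two_pow_of_length_le (hfin.image _) fun w hw => by
      obtain ⟨x, hx, rfl⟩ := hw
      exact (key x hx).1
  rw [hinj.ncard_image] at himg
  show G.ncard ≤ n ^ 2 + 2
  -- `2^{⌊log₂ n⌋ + 1} ≤ 2n ≤ n² + 2` (and the slice is empty for `n = 0`)
  have h2n : 2 * n ≤ n ^ 2 + 2 := by
    rcases Nat.lt_or_ge n 2 with hn | hn
    · interval_cases n <;> norm_num
    · calc 2 * n ≤ n * n := Nat.mul_le_mul_right n hn
        _ ≤ n ^ 2 + 2 := by rw [sq]; omega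
  rcases Nat.eq_zero_or_pos n with hn | hn
  · subst hn
    rw [Nat.log_zero_right, zero_add, pow_one] at himg
    omega
  · have hlog : 2 ^ Nat.log 2 n ≤ n := Nat.pow_log_le_self 2 (by omega)
    rw [pow_succ] at himg
    omega

/-! ### A sparse language in `P ∖ DTIME(nᵏ)` -/

/-- **For every `k` there is a SPARSE language in `P` that is not in `DTIME(nᵏ)`**: the diagonal
language of the tree's fuelled universal decider with fuel `n^{2k+3}`, restricted to the padded short
headers — sparse (`sparseHdr_isSparseLanguage`, `IsSparseLanguage.mono`), in `P`
(`FuelledSimulator.diagLang_pow_mem_P`, `sparseHdr_mem_P`, `inter_mem_P`), and outside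
`DTIME(n^{k+1}) ⊇ DTIME(nᵏ)` (`diagLang_inf_not_mem_DTIME` with `(n^{k+1})² / n^{2k+3} → 0`; every
header `e` has all its paddings `⟨e, 0ᵐ⟩`, `m ≥ 2^{|e|}`, in the restricting set).
The sparse-witness form of Hartmanis–Stearns' `DTIME(nᵏ) ⊊ P`.
[cite: HartmanisStearns1965, Thm. 9 / Cor. 9.1] [cite: AroraBarakCC2009, Thm. 3.1] -/
theorem exists_sparse_mem_P_not_mem_DTIME_pow (k : ℕ) :
    ∃ L : Language Bool, IsSparseLanguage L ∧ L ∈ Classes.P ∧ L ∉ DTIME (fun n => n ^ k) := by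
  let 𝒮 : FuelledSimulator :=
    FuelledRun.fuelledSimulator UDet.interp UDet.DR.X UDet.DR.ans UDet.interprets
  refine ⟨𝒮.diagLang (fun n => n ^ (2 * k + 3)) ⊓ ({x | ∃ (e : List Bool) (m : ℕ),
      x = boolPair e (List.replicate m false) ∧ 2 ^ e.length ≤ x.length} : Language Bool),
    ?_, ?_, fun hk => ?_⟩
  · exact sparseHdr_isSparseLanguage.mono fun x hx => hx.2
  · exact inter_mem_P (𝒮.diagLang_pow_mem_P (2 * k + 3)) sparseHdr_mem_P
  · refine diagLang_inf_not_mem_DTIME 𝒮 (T := fun n => n ^ (k + 1))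
      (U := fun n => n ^ (2 * k + 3)) (fun n => Nat.le_self_pow (Nat.succ_ne_zero k) n)
      (fun n => Nat.le_self_pow (by omega) n) (tendsto_pow_succ_sq_div_pow k)
      (fun e => ?_) (DTIME_pow_subset_DTIME_pow_succ k hk)
    refine ⟨2 ^ e.length, fun m hm => ⟨e, m, rfl, ?_⟩⟩
    rw [length_boolPair, List.length_replicate]
    omega

/-! ### PROPOSITION G′: uniform magnification for all sparse languages is the summit -/

/-- **PROPOSITION G′ (uniform magnification for ALL sparse languages IS `P ≠ NP`).** For every
`k`: the statement "every sparse language in `P` magnifies from time `nᵏ`" — i.e. for every sparse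
`L ∈ P`, `NP ⊆ P` implies `L ∈ DTIME(nᵏ)` — is equivalent to `PneNP`. (⇐) is vacuous
(`pneNP_iff_not_NP_subset_P`); (⇒) is the sparse witness of the time hierarchy
(`exists_sparse_mem_P_not_mem_DTIME_pow`). So no magnification theorem for all sparse languages
can be proved short of proving `P ≠ NP`; MMW's question "Sparse Problems?" (STOC 2019, §6) and
Atserias–Müller's "plug any sparse problem" (arXiv:2503.24061, p. 5) have, in the Turing-machine
model, the answer "that statement is the summit itself".
[cite: McKayMurrayWilliams2019, §6 ("Sparse Problems?")] [cite: HartmanisStearns1965, Thm. 9 / Cor. 9.1] -/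
theorem sparseMagnification_iff_pneNP (k : ℕ) :
    (∀ L : Language Bool, IsSparseLanguage L → L ∈ Classes.P →
        (Nondeterministic.NP ⊆ Classes.P → L ∈ DTIME (fun n => n ^ k))) ↔ PneNP := by
  rw [pneNP_iff_not_NP_subset_P]
  constructor
  · intro h hNP
    obtain ⟨L, hs, hP, hD⟩ := exists_sparse_mem_P_not_mem_DTIME_pow k
    exact hD (h L hs hP hNP)
  · intro h L _ _ hNP
    exact absurd hNP h

/-- **One explicit sparse language whose magnification statement is the summit**: for every `k`
there is a sparse `L ∈ P` (the restricted diagonal language) with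
`(NP ⊆ P → L ∈ DTIME(nᵏ)) ↔ PneNP`.
[cite: McKayMurrayWilliams2019, §6 ("Sparse Problems?")] [cite: HartmanisStearns1965, Thm. 9 / Cor. 9.1] -/
theorem exists_sparse_magnification_iff_pneNP (k : ℕ) :
    ∃ L : Language Bool, IsSparseLanguage L ∧ L ∈ Classes.P ∧
      ((Nondeterministic.NP ⊆ Classes.P → L ∈ DTIME (fun n => n ^ k)) ↔ PneNP) := by
  obtain ⟨L, hs, hP, hD⟩ := exists_sparse_mem_P_not_mem_DTIME_pow k
  refine ⟨L, hs, hP, ?_⟩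
  rw [pneNP_iff_not_NP_subset_P]
  exact ⟨fun h hNP => hD (h hNP), fun h hNP => absurd hNP h⟩

end Summit.PneNP.PneNP.Theorems.SoloBlind
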